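import Mathlib
import HarnessLib
import Literature.Computability.AlgebraicComplexity.HessianRank
import Literature.Computability.MetaComplexity.NCIPSFormulaCertificate

/-!
# Crux `RankDefectRepresentations` (stmt-PneNP-18923), line `rank-dehn-ladder`, stub `stub_cutLemma`: FORMULA CUTS

The cut lemma (negative rung N1 of the ladder) asks: if every COORDINATE CUT `X_j = R ∘ 1[row_j ≠ col_j]` of a matrix `R`
(rows coloured by `row : ι → {0,1}^n`, columns by `col : ι' → {0,1}^n`) has rank `≤ t`, is `R` within rank `poly(n)·t` of a
matrix supported on equal-colour pairs?  This file proves the SEPARATION-FORMULA UPPER BOUND, which subsumes the character cuts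
(`…CutLemmaCharacterCuts`) and product cuts (`…CutLemmaProductCuts`) landed earlier:

* `rank_formulaTwist_le` — for every arithmetic formula `𝔉` (the tree's `NCFormula K (Fin n)`, evaluated at the `0/1` point of
  a colour, so effectively a commutative formula) the TWISTED matrix `(𝔉(row x) − 𝔉(col y)) · R x y` has rank `≤ size(𝔉) · t`.
  Proof: Leibniz along the formula — a leaf `x_j` gives `± X_j`, a constant gives `0`, a sum gate adds, and a product gate
  satisfies `𝔉𝔊(a) − 𝔉𝔊(b) = 𝔉(a)(𝔊(a) − 𝔊(b)) + (𝔉(a) − 𝔉(b))𝔊(b)`, i.e. `M_{𝔉𝔊} = D · M_𝔊 + M_𝔉 · D'` with diagonal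
  `D, D'`.
* `rank_le_size_mul_of_separating` — consequently, if some formula of size `s` takes the value `1` on every row colour and `0`
  on every column colour, then `rank R ≤ s · t`: the cut lemma holds, with LINEAR loss, for every pair of colour classes of
  polynomial SEPARATION-FORMULA COMPLEXITY over `K`; the open case of `stub_cutLemma` is exactly the pairs `(S, S')` of
  super-polynomial separation complexity (e.g. random bipartitions of the cube), where no violator is known either.
Equivalent reading: `R ↦ (A_j R − R B_j)_j` (`A_j, B_j` the diagonal colour idempotents) is an "almost-Schur" operator between
representations of `K^{{0,1}^n}` with disjoint supports, and `p(A) R − R p(B) = R` for a separating `p` expands by Leibniz.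
HONEST FRAMING: a partial result toward one rung; the cut lemma, the crux, GL_noncomm and P ≠ NP are NOT touched; F-N2 is a
FRONTIER formal rung.
-/

set_option linter.dupNamespace false -- `Summit.PneNP.PneNP.…`: summit = sub-problem name (D-0017)

namespace Summit.PneNP.PneNP.Theorems.CnfIdealGenLengthRankDefectRepresentationsCutLemmaFormulaCuts

open Literature.Barriers.ValiantsHypothesis

variable {K : Type} [Field K] {n : ℕ} {ι ι' : Type} [Fintype ι] [Fintype ι'] [DecidableEq ι] [DecidableEq ι']

/-- **Separation-formula upper bound (twisted form).** If every coordinate cut of `R` has rank `≤ t`, then for every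
formula `𝔉` the matrix `((𝔉(row x) − 𝔉(col y)) · R x y)` has rank `≤ size(𝔉) · t` (values of `𝔉` at the `0/1` points of the
colours). [folklore] -/
theorem rank_formulaTwist_le (row : ι → Fin n → Bool) (col : ι' → Fin n → Bool) (R : Matrix ι ι' K) (t : ℕ)
    (hX : ∀ j : Fin n, (Matrix.of fun x y => if row x j ≠ col y j then R x y else 0).rank ≤ t) :
    ∀ 𝔉 : NCFormula K (Fin n),
      (Matrix.of fun x y =>
          (𝔉.aeval (fun j => if row x j then (1 : K) else 0) - 𝔉.aeval (fun j => if col y j then (1 : K) else 0)) *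
            R x y).rank ≤ 𝔉.size * t
  | .var j => by
      have hD : (Matrix.of fun x y =>
            ((NCFormula.var j : NCFormula K (Fin n)).aeval (fun j => if row x j then (1 : K) else 0) -
              (NCFormula.var j : NCFormula K (Fin n)).aeval (fun j => if col y j then (1 : K) else 0)) * R x y) =
          Matrix.diagonal (fun x => if row x j then (1 : K) else -1) *
            Matrix.of fun x y => if row x j ≠ col y j then R x y else 0 := by
        ext x y
        simp only [NCFormula.aeval_var, Matrix.diagonal_mul, Matrix.of_apply]
        cases row x j <;> cases col y j <;> simp
      rw [hD, NCFormula.size_var, one_mul]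
      exact (Matrix.rank_mul_le_right _ _).trans (hX j)
  | .const c => by
      have h0 : (Matrix.of fun x y =>
            ((NCFormula.const c : NCFormula K (Fin n)).aeval (fun j => if row x j then (1 : K) else 0) -
              (NCFormula.const c : NCFormula K (Fin n)).aeval (fun j => if col y j then (1 : K) else 0)) * R x y) = 0 := by
        ext x y; simp
      rw [h0, Matrix.rank_zero]; exact Nat.zero_le _
  | .add φ ψ => by
      have hφ := rank_formulaTwist_le row col R t hX φ
      have hψ := rank_formulaTwist_le row col R t hX ψ
      have hD : (Matrix.of fun x y =>
            ((NCFormula.add φ ψ).aeval (fun j => if row x j then (1 : K) else 0) -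
              (NCFormula.add φ ψ).aeval (fun j => if col y j then (1 : K) else 0)) * R x y) =
          (Matrix.of fun x y =>
            (φ.aeval (fun j => if row x j then (1 : K) else 0) - φ.aeval (fun j => if col y j then (1 : K) else 0)) *
              R x y) +
          Matrix.of fun x y =>
            (ψ.aeval (fun j => if row x j then (1 : K) else 0) - ψ.aeval (fun j => if col y j then (1 : K) else 0)) *
              R x y := by
        ext x y; simp only [NCFormula.aeval_add, Matrix.add_apply, Matrix.of_apply]; ring
      rw [hD, NCFormula.size_add]
      refine (Literature.Computability.AlgebraicComplexity.rank_add_le _ _).trans ?_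
      have : φ.size * t + ψ.size * t ≤ (φ.size + ψ.size + 1) * t := by nlinarith
      omega
  | .mul φ ψ => by
      have hφ := rank_formulaTwist_le row col R t hX φ
      have hψ := rank_formulaTwist_le row col R t hX ψ
      have hD : (Matrix.of fun x y =>
            ((NCFormula.mul φ ψ).aeval (fun j => if row x j then (1 : K) else 0) -
              (NCFormula.mul φ ψ).aeval (fun j => if col y j then (1 : K) else 0)) * R x y) =
          Matrix.diagonal (fun x => φ.aeval (fun j => if row x j then (1 : K) else 0)) *
            (Matrix.of fun x y =>
              (ψ.aeval (fun j => if row x j then (1 : K) else 0) - ψ.aeval (fun j => if col y j then (1 : K) else 0)) *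
                R x y) +
          (Matrix.of fun x y =>
            (φ.aeval (fun j => if row x j then (1 : K) else 0) - φ.aeval (fun j => if col y j then (1 : K) else 0)) *
              R x y) * Matrix.diagonal (fun y => ψ.aeval (fun j => if col y j then (1 : K) else 0)) := by
        ext x y
        simp only [NCFormula.aeval_mul, Matrix.add_apply, Matrix.diagonal_mul, Matrix.mul_diagonal, Matrix.of_apply]
        ring
      rw [hD, NCFormula.size_mul]
      refine (Literature.Computability.AlgebraicComplexity.rank_add_le _ _).trans ?_
      have h1 := (Matrix.rank_mul_le_right
        (Matrix.diagonal (fun x => φ.aeval (fun j => if row x j then (1 : K) else 0)))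
        (Matrix.of fun x y =>
          (ψ.aeval (fun j => if row x j then (1 : K) else 0) - ψ.aeval (fun j => if col y j then (1 : K) else 0)) *
            R x y)).trans hψ
      have h2 := (Matrix.rank_mul_le_left
        (Matrix.of fun x y =>
          (φ.aeval (fun j => if row x j then (1 : K) else 0) - φ.aeval (fun j => if col y j then (1 : K) else 0)) *
            R x y)
        (Matrix.diagonal (fun y => ψ.aeval (fun j => if col y j then (1 : K) else 0)))).trans hφ
      have : ψ.size * t + φ.size * t ≤ (φ.size + ψ.size + 1) * t := by nlinarith
      omega

/-- **Separation-formula upper bound for the cut lemma.** If every coordinate cut of `R` has rank `≤ t` and an arithmetic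
formula `𝔉` of size `s` over `K` takes the value `1` at (the `0/1` point of) every row colour and `0` at every column colour,
then `rank R ≤ s · t`.  In particular the cut lemma holds with linear loss for all colour-class pairs of polynomial
separation-formula complexity. [folklore] -/
theorem rank_le_size_mul_of_separating (row : ι → Fin n → Bool) (col : ι' → Fin n → Bool) (R : Matrix ι ι' K) (t : ℕ)
    (hX : ∀ j : Fin n, (Matrix.of fun x y => if row x j ≠ col y j then R x y else 0).rank ≤ t)
    (𝔉 : NCFormula K (Fin n)) (hrow : ∀ x, 𝔉.aeval (fun j => if row x j then (1 : K) else 0) = 1)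
    (hcol : ∀ y, 𝔉.aeval (fun j => if col y j then (1 : K) else 0) = 0) :
    R.rank ≤ 𝔉.size * t := by
  have h := rank_formulaTwist_le row col R t hX 𝔉
  have hR : (Matrix.of fun x y =>
      (𝔉.aeval (fun j => if row x j then (1 : K) else 0) - 𝔉.aeval (fun j => if col y j then (1 : K) else 0)) *
        R x y) = R := by
    ext x y; simp [hrow x, hcol y]
  rwa [hR] at h

/-- The cut lemma's conclusion, in the registered shape, for DISJOINT colourings separated by a formula of size `s`: the
equal-colour part may be taken to be `0` and the loss is `s · t`. [folklore] -/
theorem cutLemma_of_separating (row : ι → Fin n → Bool) (col : ι' → Fin n → Bool) (t : ℕ) (R : Matrix ι ι' K)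
    (hX : ∀ j : Fin n, (Matrix.of fun x y => if row x j ≠ col y j then R x y else 0).rank ≤ t)
    (𝔉 : NCFormula K (Fin n)) (hrow : ∀ x, 𝔉.aeval (fun j => if row x j then (1 : K) else 0) = 1)
    (hcol : ∀ y, 𝔉.aeval (fun j => if col y j then (1 : K) else 0) = 0) :
    ∃ R' : Matrix ι ι' K, (∀ x y, row x ≠ col y → R' x y = 0) ∧ (R - R').rank ≤ 𝔉.size * t :=
  ⟨0, fun _ _ _ => rfl, by rw [sub_zero]; exact rank_le_size_mul_of_separating row col R t hX 𝔉 hrow hcol⟩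

end Summit.PneNP.PneNP.Theorems.CnfIdealGenLengthRankDefectRepresentationsCutLemmaFormulaCuts
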